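import Literature.AnabelianGeometry.SemiGraphs.PSCGraphicTransport
import Literature.AnabelianGeometry.SemiGraphs.PSCEdgewiseCriterionProofs
import Literature.AnabelianGeometry.SemiGraphs.PSCUnrTransportProofs
import HarnessLib

/-!
# [CombGC] Definition 1.4 (i)–(iv): the properties of `α`, `β` are closed under identity, inverse and composition

Mochizuki, *A combinatorial version of the Grothendieck conjecture*, Tohoku Math. J. **59** (2007)
[CombGC], §1, Definition 1.4 (i)–(iv), author's manuscript pp. 10–11 (graphic; numerically cuspidal;
verticially / edge-wise / graphically filtration-preserving; group-theoretically cuspidal / edge-like /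
verticial — for `α : Π_G ⥲ Π_H` and for `β : Π^unr_G ⥲ Π^unr_H`), and the proof of Theorem 1.6 (ii),
p. 14 l.12: "let us first observe that by *functoriality* … we may always replace `G`, `H` by finite
étale `Π_G`- or `Π_H`-coverings that correspond via `α`", resp. p. 14 l.18–21 "replacing `α` by the
isomorphism induced by `α` between the respective quotients".  Every such replacement composes the
given isomorphism with identifications on either side; what makes this harmless is that each of the
eight properties of Def. 1.4 cuts out a WIDE SUBGROUPOID of the groupoid of bi-continuous group
isomorphisms: it holds for the identity, for `α⁻¹` when it holds for `α`, and for `α' ∘ α` when it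
holds for `α` and `α'`.  [cite: MochizukiCombGC2007, Def 1.4 pp.10-11]

PROOF-ONLY companion of `PSCGraphicity.lean` (statements of record, abc-iut-L3-t4; DEFS-FREEZE
respected: nothing there is edited or restated; 0 definitions here).  abc-iut cell, block F, seat
abc-iut-f-163 (tranche 163 = FACT-LIST rows F-0444 / F-0446 / F-0457, all three kernel-settled before
this seat by abc-iut-L3-t4 g5 / abc-iut-L5-t6 g5: closures refuted, instance forms landed).  This file
adds the instance forms "at `id`, at `α⁻¹`, at `α' ∘ α`" of the VOCABULARY row F-0446
`IsEdgewiseFiltrationPreserving` (Def. 1.4 (iii)) and of its seven Def-1.4 companions.  Already in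
the tree (used BY NAME, not re-proved): `isGraphic_refl` (`PSCGraphicProofs`), `IsGraphic.symm`
(`PSCGraphicTransport`), `IsNumericallyCuspidal.symm` (`PSCCuspidalCriterionProofs`),
`IsEdgewiseFiltrationPreserving.symm` (`PSCEdgewiseCriterionProofs`),
`IsUnrVerticiallyFiltrationPreserving.symm` (`PSCUnrTransportProofs`).  New here:

* `α : Π_G ⥲ Π_H`, `α' : Π_H ⥲ Π_K`: `IsGraphic.trans`; `isNumericallyCuspidal_refl`,
  `IsNumericallyCuspidal.trans`; `is{Verticially,Edgewise,Graphically}FiltrationPreserving_refl`,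
  `IsVerticiallyFiltrationPreserving.symm`, `IsGraphicallyFiltrationPreserving.symm`,
  `Is{Verticially,Edgewise,Graphically}FiltrationPreserving.trans`;
  `isGroupTheoretically{Cuspidal,EdgeLike,Verticial}_refl`, `….symm`, `….trans`;
* `β : Π^unr_G ⥲ Π^unr_H`, `β' : Π^unr_H ⥲ Π^unr_K` (transport `unrTransport` of subgroups
  containing the kernels): `unrTransport_refl`, `unrTransport_trans`;
  `isUnrVerticiallyFiltrationPreserving_refl`, `IsUnrVerticiallyFiltrationPreserving.trans`;
  `isUnrGroupTheoreticallyVerticial_refl`, `IsUnrGroupTheoreticallyVerticial.symm`, `….trans`.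

All of it holds for ALL data over the interface `PSCDatum Π` (no origin hypothesis, no compactness,
any `Σ`): formal properties of images of subgroups under group isomorphisms.  Nothing here asserts a
FACT-LIST row; nothing takes a side on [IUTchIII] Cor. 3.12.
-/

noncomputable section

namespace Literature.AnabelianGeometry.SemiGraphs

namespace PSCDatum

open scoped Pointwise

universe u

variable {P : Type u} [Group P] [TopologicalSpace P] [IsTopologicalGroup P]
variable {P' : Type u} [Group P'] [TopologicalSpace P'] [IsTopologicalGroup P']
variable {P'' : Type u} [Group P''] [TopologicalSpace P''] [IsTopologicalGroup P'']

/-! ### Images of subgroups under `id` and `α' ∘ α` -/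

section Images

variable (α : P ≃ₜ* P') (α' : P' ≃ₜ* P'')

omit [IsTopologicalGroup P] in
/-- The image of a subgroup under the identity isomorphism is itself.
[cite: MochizukiCombGC2007, Def 1.4(i) p.10] -/
theorem map_continuousMulEquiv_refl (S : Subgroup P) :
    S.map (ContinuousMulEquiv.refl P).toMulEquiv.toMonoidHom = S :=
  Subgroup.map_id S

omit [IsTopologicalGroup P] [IsTopologicalGroup P'] [IsTopologicalGroup P''] in
/-- The image of a subgroup under `α' ∘ α` is the image under `α'` of the image under `α`.
[cite: MochizukiCombGC2007, Def 1.4(i) p.10] -/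
theorem map_continuousMulEquiv_trans (S : Subgroup P) :
    S.map (α.trans α').toMulEquiv.toMonoidHom =
      (S.map α.toMulEquiv.toMonoidHom).map α'.toMulEquiv.toMonoidHom := by
  rw [Subgroup.map_map]
  rfl

omit [IsTopologicalGroup P] [IsTopologicalGroup P'] [IsTopologicalGroup P''] in
/-- Composition of "carries the conjugacy class of `S` into that of `T`" with "carries the class of
`T` into that of `R`". [cite: MochizukiCombGC2007, Def 1.4(i) p.10] -/
theorem exists_smul_map_trans {S : Subgroup P} {T : Subgroup P'} {R : Subgroup P''}
    (h : ∃ γ : ConjAct P', S.map α.toMulEquiv.toMonoidHom = γ • T)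
    (h' : ∃ γ' : ConjAct P'', T.map α'.toMulEquiv.toMonoidHom = γ' • R) :
    ∃ δ : ConjAct P'', S.map (α.trans α').toMulEquiv.toMonoidHom = δ • R := by
  obtain ⟨γ, hγ⟩ := h
  obtain ⟨γ', hγ'⟩ := h'
  refine ⟨ConjAct.toConjAct (α'.toMulEquiv.toMonoidHom (ConjAct.ofConjAct γ)) * γ', ?_⟩
  rw [map_continuousMulEquiv_trans, hγ, map_conj_smul, hγ', mul_smul]

end Images

/-! ### The two-sided transport pattern of Def. 1.4 (iv) ("maps each 𝒳-subgroup of `Π_G`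
isomorphically onto a 𝒴-subgroup of `Π_H`, and every 𝒴-subgroup of `Π_H` arises in this fashion") -/

section BiTransport

variable {α : P ≃ₜ* P'} {α' : P' ≃ₜ* P''}
variable {𝒳 : Subgroup P → Prop} {𝒴 : Subgroup P' → Prop} {𝒵 : Subgroup P'' → Prop}

omit [IsTopologicalGroup P] in
/-- The pattern of Def. 1.4 (iv) holds for the identity (same class of subgroups on both sides).
[cite: MochizukiCombGC2007, Def 1.4(iv) p.11] -/
theorem biTransport_refl (𝒳 : Subgroup P → Prop) :
    (∀ A, 𝒳 A → 𝒳 (A.map (ContinuousMulEquiv.refl P).toMulEquiv.toMonoidHom)) ∧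
      ∀ B, 𝒳 B → ∃ A, 𝒳 A ∧ A.map (ContinuousMulEquiv.refl P).toMulEquiv.toMonoidHom = B :=
  ⟨fun A hA => by rwa [map_continuousMulEquiv_refl],
    fun B hB => ⟨B, hB, map_continuousMulEquiv_refl B⟩⟩

omit [IsTopologicalGroup P] [IsTopologicalGroup P'] in
/-- The pattern of Def. 1.4 (iv) for `α` (classes `𝒳`, `𝒴`) gives the pattern for `α⁻¹` (classes
`𝒴`, `𝒳`). [cite: MochizukiCombGC2007, Def 1.4(iv) p.11] -/
theorem biTransport_symm
    (h : (∀ A, 𝒳 A → 𝒴 (A.map α.toMulEquiv.toMonoidHom)) ∧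
      ∀ B, 𝒴 B → ∃ A, 𝒳 A ∧ A.map α.toMulEquiv.toMonoidHom = B) :
    (∀ B, 𝒴 B → 𝒳 (B.map α.symm.toMulEquiv.toMonoidHom)) ∧
      ∀ A, 𝒳 A → ∃ B, 𝒴 B ∧ B.map α.symm.toMulEquiv.toMonoidHom = A := by
  have e : ∀ A : Subgroup P,
      (A.map α.toMulEquiv.toMonoidHom).map α.symm.toMulEquiv.toMonoidHom = A :=
    fun A => map_symm_map α.toMulEquiv A
  refine ⟨fun B hB => ?_, fun A hA => ⟨_, h.1 A hA, e A⟩⟩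
  obtain ⟨A, hA, rfl⟩ := h.2 B hB
  rwa [e A]

omit [IsTopologicalGroup P] [IsTopologicalGroup P'] [IsTopologicalGroup P''] in
/-- The pattern of Def. 1.4 (iv) for `α` (classes `𝒳`, `𝒴`) and for `α'` (classes `𝒴`, `𝒵`) gives
the pattern for `α' ∘ α` (classes `𝒳`, `𝒵`). [cite: MochizukiCombGC2007, Def 1.4(iv) p.11] -/
theorem biTransport_trans
    (h : (∀ A, 𝒳 A → 𝒴 (A.map α.toMulEquiv.toMonoidHom)) ∧
      ∀ B, 𝒴 B → ∃ A, 𝒳 A ∧ A.map α.toMulEquiv.toMonoidHom = B)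
    (h' : (∀ B, 𝒴 B → 𝒵 (B.map α'.toMulEquiv.toMonoidHom)) ∧
      ∀ C, 𝒵 C → ∃ B, 𝒴 B ∧ B.map α'.toMulEquiv.toMonoidHom = C) :
    (∀ A, 𝒳 A → 𝒵 (A.map (α.trans α').toMulEquiv.toMonoidHom)) ∧
      ∀ C, 𝒵 C → ∃ A, 𝒳 A ∧ A.map (α.trans α').toMulEquiv.toMonoidHom = C := by
  refine ⟨fun A hA => ?_, fun C hC => ?_⟩
  · rw [map_continuousMulEquiv_trans]
    exact h'.1 _ (h.1 A hA)
  · obtain ⟨B, hB, rfl⟩ := h'.2 C hC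
    obtain ⟨A, hA, rfl⟩ := h.2 B hB
    exact ⟨A, hA, map_continuousMulEquiv_trans α α' A⟩

end BiTransport

/-! ### Definition 1.4 (i), (ii), (iv) for `α` -/

section Alpha

variable {G : PSCDatum P} {H : PSCDatum P'} {K : PSCDatum P''} {α : P ≃ₜ* P'} {α' : P' ≃ₜ* P''}

omit [IsTopologicalGroup P] [IsTopologicalGroup P'] [IsTopologicalGroup P''] in
/-- **Graphicity is transitive** (Def. 1.4 (i)): if `α` is graphic via `ι` and `α'` via `ι'`, then
`α' ∘ α` is graphic via `ι' ∘ ι` (isomorphisms of semi-graphs of anabelioids compose).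
[cite: MochizukiCombGC2007, Def 1.4(i) p.10] -/
theorem IsGraphic.trans (h : G.IsGraphic H α) (h' : H.IsGraphic K α') :
    G.IsGraphic K (α.trans α') := by
  obtain ⟨ι, hv, hn, hc⟩ := h
  obtain ⟨ι', hv', hn', hc'⟩ := h'
  refine ⟨⟨ι.vertEquiv.trans ι'.vertEquiv, ι.nodeEquiv.trans ι'.nodeEquiv,
      ι.cuspEquiv.trans ι'.cuspEquiv, fun e => ?_, fun c => ?_⟩,
    fun v => ?_, fun e => ?_, fun c => ?_⟩
  · rw [Equiv.trans_apply, ι'.nodeEnds_comm, ι.nodeEnds_comm, Sym2.map_map]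
    rfl
  · rw [Equiv.trans_apply, ι'.cuspEnd_comm, ι.cuspEnd_comm]
    rfl
  · exact exists_smul_map_trans α α' (hv v) (hv' (ι.vertEquiv v))
  · exact exists_smul_map_trans α α' (hn e) (hn' (ι.nodeEquiv e))
  · exact exists_smul_map_trans α α' (hc c) (hc' (ι.cuspEquiv c))

omit [IsTopologicalGroup P] in
/-- The identity of `Π_G` is numerically cuspidal. [cite: MochizukiCombGC2007, Def 1.4(ii) p.10] -/
theorem isNumericallyCuspidal_refl (G : PSCDatum P) :
    G.IsNumericallyCuspidal G (ContinuousMulEquiv.refl P) := fun U _ => by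
  rw [map_continuousMulEquiv_refl]

omit [IsTopologicalGroup P] [IsTopologicalGroup P'] [IsTopologicalGroup P''] in
/-- **Numerical cuspidality is transitive**: if `α` and `α'` are numerically cuspidal then so is
`α' ∘ α` (`r(G') = r(H') = r(K')` for corresponding coverings).
[cite: MochizukiCombGC2007, Def 1.4(ii) p.10] -/
theorem IsNumericallyCuspidal.trans (h : G.IsNumericallyCuspidal H α)
    (h' : H.IsNumericallyCuspidal K α') : G.IsNumericallyCuspidal K (α.trans α') := fun U hU => by
  rw [h U hU, h' _ (isOpen_map α U hU), map_continuousMulEquiv_trans]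

omit [IsTopologicalGroup P] in
/-- The identity of `Π_G` is group-theoretically cuspidal. [cite: MochizukiCombGC2007, Def 1.4(iv) p.11] -/
theorem isGroupTheoreticallyCuspidal_refl (G : PSCDatum P) :
    G.IsGroupTheoreticallyCuspidal G (ContinuousMulEquiv.refl P) := biTransport_refl G.IsCuspidal

omit [IsTopologicalGroup P] in
/-- The identity of `Π_G` is group-theoretically edge-like. [cite: MochizukiCombGC2007, Def 1.4(iv) p.11] -/
theorem isGroupTheoreticallyEdgeLike_refl (G : PSCDatum P) :
    G.IsGroupTheoreticallyEdgeLike G (ContinuousMulEquiv.refl P) := biTransport_refl G.IsEdgeLike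

omit [IsTopologicalGroup P] in
/-- The identity of `Π_G` is group-theoretically verticial. [cite: MochizukiCombGC2007, Def 1.4(iv) p.11] -/
theorem isGroupTheoreticallyVerticial_refl (G : PSCDatum P) :
    G.IsGroupTheoreticallyVerticial G (ContinuousMulEquiv.refl P) := biTransport_refl G.IsVerticial

omit [IsTopologicalGroup P] [IsTopologicalGroup P'] in
/-- If `α` is group-theoretically cuspidal then so is `α⁻¹`. [cite: MochizukiCombGC2007, Def 1.4(iv) p.11] -/
theorem IsGroupTheoreticallyCuspidal.symm (h : G.IsGroupTheoreticallyCuspidal H α) :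
    H.IsGroupTheoreticallyCuspidal G α.symm := biTransport_symm h

omit [IsTopologicalGroup P] [IsTopologicalGroup P'] in
/-- If `α` is group-theoretically edge-like then so is `α⁻¹`. [cite: MochizukiCombGC2007, Def 1.4(iv) p.11] -/
theorem IsGroupTheoreticallyEdgeLike.symm (h : G.IsGroupTheoreticallyEdgeLike H α) :
    H.IsGroupTheoreticallyEdgeLike G α.symm := biTransport_symm h

omit [IsTopologicalGroup P] [IsTopologicalGroup P'] in
/-- If `α` is group-theoretically verticial then so is `α⁻¹`. [cite: MochizukiCombGC2007, Def 1.4(iv) p.11] -/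
theorem IsGroupTheoreticallyVerticial.symm (h : G.IsGroupTheoreticallyVerticial H α) :
    H.IsGroupTheoreticallyVerticial G α.symm := biTransport_symm h

omit [IsTopologicalGroup P] [IsTopologicalGroup P'] [IsTopologicalGroup P''] in
/-- **Group-theoretic cuspidality is transitive**. [cite: MochizukiCombGC2007, Def 1.4(iv) p.11] -/
theorem IsGroupTheoreticallyCuspidal.trans (h : G.IsGroupTheoreticallyCuspidal H α)
    (h' : H.IsGroupTheoreticallyCuspidal K α') : G.IsGroupTheoreticallyCuspidal K (α.trans α') :=
  biTransport_trans h h'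

omit [IsTopologicalGroup P] [IsTopologicalGroup P'] [IsTopologicalGroup P''] in
/-- **Group-theoretic edge-likeness is transitive**. [cite: MochizukiCombGC2007, Def 1.4(iv) p.11] -/
theorem IsGroupTheoreticallyEdgeLike.trans (h : G.IsGroupTheoreticallyEdgeLike H α)
    (h' : H.IsGroupTheoreticallyEdgeLike K α') : G.IsGroupTheoreticallyEdgeLike K (α.trans α') :=
  biTransport_trans h h'

omit [IsTopologicalGroup P] [IsTopologicalGroup P'] [IsTopologicalGroup P''] in
/-- **Group-theoretic verticiality is transitive**. [cite: MochizukiCombGC2007, Def 1.4(iv) p.11] -/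
theorem IsGroupTheoreticallyVerticial.trans (h : G.IsGroupTheoreticallyVerticial H α)
    (h' : H.IsGroupTheoreticallyVerticial K α') : G.IsGroupTheoreticallyVerticial K (α.trans α') :=
  biTransport_trans h h'

/-! ### Definition 1.4 (iii) for `α`: verticially / edge-wise / graphically filtration-preserving -/

/-- The identity of `Π_G` is verticially filtration-preserving.
[cite: MochizukiCombGC2007, Def 1.4(iii) p.10] -/
theorem isVerticiallyFiltrationPreserving_refl (G : PSCDatum P) :
    G.IsVerticiallyFiltrationPreserving G (ContinuousMulEquiv.refl P) := fun U _ => by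
  rw [map_continuousMulEquiv_refl, map_continuousMulEquiv_refl]

/-- The identity of `Π_G` is edge-wise filtration-preserving (instance form at `id` of the vocabulary
row F-0446). [cite: MochizukiCombGC2007, Def 1.4(iii) p.10] -/
theorem isEdgewiseFiltrationPreserving_refl (G : PSCDatum P) :
    G.IsEdgewiseFiltrationPreserving G (ContinuousMulEquiv.refl P) := fun U _ => by
  rw [map_continuousMulEquiv_refl, map_continuousMulEquiv_refl]

/-- The identity of `Π_G` is graphically filtration-preserving.
[cite: MochizukiCombGC2007, Def 1.4(iii) p.10] -/
theorem isGraphicallyFiltrationPreserving_refl (G : PSCDatum P) :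
    G.IsGraphicallyFiltrationPreserving G (ContinuousMulEquiv.refl P) :=
  ⟨isVerticiallyFiltrationPreserving_refl G, isEdgewiseFiltrationPreserving_refl G⟩

/-- If `α` is verticially filtration-preserving then so is `α⁻¹` (verticial twin of
`IsEdgewiseFiltrationPreserving.symm`). [cite: MochizukiCombGC2007, Def 1.4(iii) p.10] -/
theorem IsVerticiallyFiltrationPreserving.symm (h : G.IsVerticiallyFiltrationPreserving H α) :
    H.IsVerticiallyFiltrationPreserving G α.symm := by
  intro U' hU'
  have hU := isOpen_comap α U' hU'
  have key := h _ hU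
  rw [Subgroup.map_comap_eq_self_of_surjective α.surjective] at key
  have key' := congrArg (Subgroup.comap α.toMulEquiv.toMonoidHom) key
  rw [Subgroup.comap_map_eq_self_of_injective α.injective] at key'
  rw [map_symm_eq_comap α, map_symm_eq_comap α]
  exact key'.symm

/-- If `α` is graphically filtration-preserving then so is `α⁻¹`.
[cite: MochizukiCombGC2007, Def 1.4(iii) p.10] -/
theorem IsGraphicallyFiltrationPreserving.symm (h : G.IsGraphicallyFiltrationPreserving H α) :
    H.IsGraphicallyFiltrationPreserving G α.symm :=
  ⟨h.1.symm, h.2.symm⟩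

/-- **Verticial filtration-preservation is transitive**: `α`, `α'` verticially filtration-preserving
⟹ `α' ∘ α` verticially filtration-preserving. [cite: MochizukiCombGC2007, Def 1.4(iii) p.10] -/
theorem IsVerticiallyFiltrationPreserving.trans (h : G.IsVerticiallyFiltrationPreserving H α)
    (h' : H.IsVerticiallyFiltrationPreserving K α') :
    G.IsVerticiallyFiltrationPreserving K (α.trans α') := fun U hU => by
  rw [map_continuousMulEquiv_trans, h U hU, h' _ (isOpen_map α U hU),
    ← map_continuousMulEquiv_trans]

/-- **Edge-wise filtration-preservation is transitive** (instance form at composites of the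
vocabulary row F-0446). [cite: MochizukiCombGC2007, Def 1.4(iii) p.10] -/
theorem IsEdgewiseFiltrationPreserving.trans (h : G.IsEdgewiseFiltrationPreserving H α)
    (h' : H.IsEdgewiseFiltrationPreserving K α') :
    G.IsEdgewiseFiltrationPreserving K (α.trans α') := fun U hU => by
  rw [map_continuousMulEquiv_trans, h U hU, h' _ (isOpen_map α U hU),
    ← map_continuousMulEquiv_trans]

/-- **Graphical filtration-preservation is transitive**. [cite: MochizukiCombGC2007, Def 1.4(iii) p.10] -/
theorem IsGraphicallyFiltrationPreserving.trans (h : G.IsGraphicallyFiltrationPreserving H α)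
    (h' : H.IsGraphicallyFiltrationPreserving K α') :
    G.IsGraphicallyFiltrationPreserving K (α.trans α') :=
  ⟨h.1.trans h'.1, h.2.trans h'.2⟩

end Alpha

/-! ### Definition 1.4 (iii)/(iv) for `β : Π^unr_G ⥲ Π^unr_H`: identity, inverse, composition -/

section Unr

variable (G : PSCDatum P) (H : PSCDatum P') (K : PSCDatum P'')
variable (β : (P ⧸ G.unrKer) ≃ₜ* (P' ⧸ H.unrKer)) (β' : (P' ⧸ H.unrKer) ≃ₜ* (P'' ⧸ K.unrKer))

/-- Transport along the identity of `Π^unr_G` fixes every subgroup containing `Ker(Π_G ↠ Π^unr_G)`.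
[cite: MochizukiCombGC2007, Def 1.4(iii) p.10] -/
theorem unrTransport_refl {S : Subgroup P} (hS : G.unrKer ≤ S) :
    G.unrTransport G (ContinuousMulEquiv.refl _) S = S := by
  unfold unrTransport
  have hid : (ContinuousMulEquiv.refl (P ⧸ G.unrKer)).toMulEquiv.toMonoidHom = MonoidHom.id _ :=
    rfl
  rw [hid, Subgroup.map_id, Subgroup.comap_map_eq, QuotientGroup.ker_mk', sup_eq_left.mpr hS]

/-- Transport along `β' ∘ β` is the composite of the transports (the middle projection
`Π_H ↠ Π^unr_H` is surjective). [cite: MochizukiCombGC2007, Def 1.4(iii) p.10] -/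
theorem unrTransport_trans (S : Subgroup P) :
    G.unrTransport K (β.trans β') S = H.unrTransport K β' (G.unrTransport H β S) := by
  unfold unrTransport
  rw [Subgroup.map_comap_eq_self_of_surjective (QuotientGroup.mk'_surjective _)]
  simp only [Subgroup.map_map]
  rfl

variable {G H K β β'}

/-- The identity of `Π^unr_G` is verticially filtration-preserving.
[cite: MochizukiCombGC2007, Def 1.4(iii) p.10] -/
theorem isUnrVerticiallyFiltrationPreserving_refl (G : PSCDatum P) :
    G.IsUnrVerticiallyFiltrationPreserving G (ContinuousMulEquiv.refl _) := fun U _ hKU => by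
  rw [G.unrTransport_refl hKU, G.unrTransport_refl (G.unrKer_le_vertFil hKU)]

/-- **Verticial filtration-preservation of `β` is transitive**.
[cite: MochizukiCombGC2007, Def 1.4(iii) p.10] -/
theorem IsUnrVerticiallyFiltrationPreserving.trans (h : G.IsUnrVerticiallyFiltrationPreserving H β)
    (h' : H.IsUnrVerticiallyFiltrationPreserving K β') :
    G.IsUnrVerticiallyFiltrationPreserving K (β.trans β') := fun U hU hKU => by
  rw [G.unrTransport_trans H K β β', G.unrTransport_trans H K β β', h U hU hKU,
    h' _ (G.isOpen_unrTransport H β hU) (G.unrKer_le_unrTransport H β U)]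

/-- The identity of `Π^unr_G` is group-theoretically verticial (every unramified verticial subgroup
contains the kernel, so the identity transport fixes it). [cite: MochizukiCombGC2007, Def 1.4(iv) p.11] -/
theorem isUnrGroupTheoreticallyVerticial_refl (G : PSCDatum P) :
    G.IsUnrGroupTheoreticallyVerticial G (ContinuousMulEquiv.refl _) := by
  refine ⟨fun B hB => ?_, fun B' hB' => ⟨B', hB', ?_⟩⟩
  · obtain ⟨A, hA, rfl⟩ := hB
    rw [G.unrTransport_refl le_sup_right]
    exact ⟨A, hA, rfl⟩
  · obtain ⟨A, hA, rfl⟩ := hB'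
    exact G.unrTransport_refl le_sup_right

/-- If `β` is group-theoretically verticial then so is `β⁻¹`. [cite: MochizukiCombGC2007, Def 1.4(iv) p.11] -/
theorem IsUnrGroupTheoreticallyVerticial.symm (h : G.IsUnrGroupTheoreticallyVerticial H β) :
    H.IsUnrGroupTheoreticallyVerticial G β.symm := by
  refine ⟨fun B' hB' => ?_, fun B hB => ⟨G.unrTransport H β B, h.1 B hB, ?_⟩⟩
  · obtain ⟨B, hB, rfl⟩ := h.2 B' hB'
    obtain ⟨A, hA, rfl⟩ := hB
    rw [G.unrTransport_symm_unrTransport H β le_sup_right]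
    exact ⟨A, hA, rfl⟩
  · obtain ⟨A, hA, rfl⟩ := hB
    exact G.unrTransport_symm_unrTransport H β le_sup_right

/-- **Group-theoretic verticiality of `β` is transitive**. [cite: MochizukiCombGC2007, Def 1.4(iv) p.11] -/
theorem IsUnrGroupTheoreticallyVerticial.trans (h : G.IsUnrGroupTheoreticallyVerticial H β)
    (h' : H.IsUnrGroupTheoreticallyVerticial K β') :
    G.IsUnrGroupTheoreticallyVerticial K (β.trans β') := by
  refine ⟨fun B hB => ?_, fun B'' hB'' => ?_⟩
  · rw [G.unrTransport_trans H K β β']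
    exact h'.1 _ (h.1 B hB)
  · obtain ⟨B', hB', rfl⟩ := h'.2 B'' hB''
    obtain ⟨B, hB, rfl⟩ := h.2 B' hB'
    exact ⟨B, hB, G.unrTransport_trans H K β β' B⟩

end Unr

end PSCDatum

end Literature.AnabelianGeometry.SemiGraphs

end
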